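import Literature.MathematicalPhysics.QuantumFieldTheory.Balaban1983to89.T4TowerRateDischarge

/-!
# `Balaban1983to89.T4TermwiseBudget` — TERM-WISE MATCHING ALONG THE TOWER, III: node U5's PER-TERM BUDGET
(`T4GoodClassBudget.TermBudget`) BUILT from a flat two-run factor ledger with the crossover centring, the good clause with a
SUMMABLE radius, and the end-to-end composition from the sibling nodes' typed outputs (cell `pub-balaban`, T4-DAG §5 node
U5 / estimate NE7, technique "term-wise": bound `δ_K` from NE2–NE5's rates composed along the tower, summability from the
geometric factors; lineage t4-ne7-p1, generation 3; record `t4/T4-EST-NE7-P1.md` v3; journal row `T4-U5.E-NE7-PROVE-P1-G3*`)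

HONEST FRAMING (cell `pub-balaban`, T4-DAG PAGE 1).  The cell's T4 target is the existence AND uniqueness of the continuum
limit of Bałaban's unit-scale averaged loop expectations on a FINITE torus, rung (B)+1 of the cell's ladder — strictly
beyond ultraviolet stability ([Balaban1989LargeFieldII] Thm 1 p. 355); it is NOT infinite volume, NOT the Yang–Mills mass
gap and NOT the Clay problem.  Estimate NE7 — node U5: `∀ K ∃ c_K ∀ |t| ≤ l₀, |log Z^B_{K+1}(t) − log Z^A_K(t) − c_K| ≤
δ_K|T₁|` with `Σ_K δ_K < ∞` — is NOT PRINTED anywhere and this module does NOT prove it.  NE7 has two halves in the tree's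
bookkeeping (`T4GoodClassBudget.cauchy_of_goodClause`): the GOOD-CLASS clause `GoodClause … δ` with `Summable δ`, and the
WEIGHT budget `RelWeightBound` of the bad class.  This module concerns the FIRST half only, for the TERM-WISE profile, and
delivers it MODULO NAMED BINDERS (listed below) none of which is printed as a two-run statement; the weight half is the
sibling seats' (techniques "weight" / "variance": rows P2/P3, NE7b, NE7c) and is not touched.  What is kernel-checked:
* §1 ONE TERM.  `density_logBound_of_centring`: for a finite ledger of positive factors in two runs, every creation-scale
  slice `j ≤ K` of `log f^B − log f^A` lying within a SIZE radius `S j` of a size centre `κ₁ j` AND within a RATE radius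
  `ρ j` of a rate centre `κ₂ j`, and the aggregated OTHER KINDS within `RO` of `cO`, the two runs' densities have log-ratio
  within `Σ_{j ≤ K} min(S j, ρ j) + RO` of the FIELD-INDEPENDENT constant `Σ_{j ≤ K} sliceCentre κ₁ κ₂ S ρ j + cO`
  (`T4GoodClassBudget.abs_log_prod_sub_le_crossover` — which had no consumer in the tree — composed with the other kinds);
  `density_sandwich_of_centring` (pointwise sandwich; off the admissible set both densities VANISH — node U5a's synchronised
  characteristic functions, a binder); `term_sandwich_of_centring` (the pending positive integral,
  `T4HybridMatching.integral_sandwich`: literally the `nonneg`/`lower`/`upper` fields of `TermBudget` for that term);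
  `sliceMin_le_eShape` (the E-branch of the crossover per unit volume with ANY rate constant `Cr ≥ 0`:
  `Σ_j min ≤ vol·max(Cw,1)·(E + Cr)·Σ_{j+n=K} min(aⁿ, θ^jΛⁿ)`).
* §2 THE RATE SLICE FROM THE TOWER.  `rateSlice_of_uRateUpTo`: the lineage's composed two-run rate `URateUpTo K` (node U3 up
  to cutoff `K`, `T4TowerRateComposition`; NOT PRINTED) and `T4RecentScale.Multiplicity` (NOT PRINTED for a two-run ledger)
  PRODUCE the rate centring of every slice of a (2.25)-shaped E-group: centre `Σ_{scale X = j} −(E^B(X; g^B, U₁^B) −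
  E^A(X; g^A, U₁^A))`, radius `Cw·vol·(E₀′ θ^j Λ^{K−j})`.
* §3 THE FAMILY.  `termBudget_of_ledger`: the per-term budget `TermBudget l₀ vol T A B Bad Cc Rr c₀ r s` of node U5 with
  EXPLICIT centred constants `Cc`, radii `Rr` and remainder rate `r K = max(Cw,1)·(E + Cr_K)·Σ_{j+n=K} min(aⁿ, θ^jΛⁿ) + rO K`,
  from nineteen binders — thirteen substantive + six sign conditions (term format as pending positive integrals of
  ledger × other kinds; positivity on / vanishing off
  the admissible set; integrability; the two centrings with `S ≤ vol·E·a^{K−j}`, `ρ ≤ Cw·vol·(Cr_K θ^j Λ^{K−j})`; other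
  kinds `RO ≤ vol·rO K`; hazard H-U5b-1 `|Cc − c₀ K| ≤ vol·s K` ON THE CHOSEN CENTRES) — obligation O-b2 of
  `T4MatchingClosure` («instantiating the recent part from the per-kind `T4RecentScale.FactorLogRatio` hypotheses with the
  §1 choice of centring … stays with the producers») for the E-group of the term-wise profile;
  `goodClause_summable_of_ledgerBudget` (⇒ `GoodClause … (r + s) ∧ Summable (r + s)` given summable E-branch, `rO`, `s`)
  and `…_poly` (`Cr_K = C(K+1)^p`: `T4TowerRateComposition.summable_eBranch_poly`); §3b `termBudget_of_towerRate`: the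
  same with the E-group in the (2.25) shape `exp(E(X; g_K, U(v)) − E(X; g_K, U₁))` and the rate centring NO LONGER A BINDER
  (fed by §2 from `URateUpTo K` per good term + multiplicity); §3c `termBudget_of_nodes` / `goodClause_summable_of_nodes`:
  END TO END from the sibling nodes' typed outputs exactly as consumed by `T4TowerRateDischarge.uRateUpTo_of_nodes` (NE9 +
  fading memory, Lipschitz-in-the-background with polynomial growth, NE5, NE3 = `T4EtaRateMin.LocalRate` + the liaison
  `T4RateLiaison.GaugeDominated`, node U2's `InjectedRate … disc` on the printed box, both runs' couplings in the window,
  any common rate `θ′` with `max(ω, θc) < θ′`, `θ₅, θ₃ ≤ θ′`) ⇒ `∃ Cr ≥ 0` (the tower's constant, UNIFORM IN `K`) such that,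
  granted H-U5b-1 on the centres chosen with that `Cr`, `TermBudget` holds, and for `0 < a < 1`, `θ′ < 1`, `θ′ ≤ Λ`,
  summable `rO`, `s`: `GoodClause l₀ vol T A B Bad δ ∧ Summable δ` with
  `δ K = max(Cw,1)·(E + Cr)·Σ_{j+n=K} min(aⁿ, θ′^jΛⁿ) + rO K + s K` — the `hgood`/`hδ` inputs of `cauchy_of_goodClause`.
* §4 SANITY.  `toy_termBudget_nonvacuous`: two toy runs that differ at every cutoff satisfy all nineteen binders of
  `termBudget_of_ledger` at once, with a summable `δ` (consistency of the binder set and of the sandwich orientation; no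
  physics).

THE BINDERS LEFT STANDING (the carver's census of what this route does NOT supply; each NOT PRINTED as a two-run statement;
T4-DAG node U5 / U5a / U5b, record v3 §4):
(F) TERM FORMAT — each good term of node U5a's common index set is a pending positive integral `∫ (∏_{ledger} f)·o dμ` in
    BOTH runs over a common space of driving fields, the ledger holding the matched E-group pairs of creation scale `≤ K`
    and `o` every other factor.  Print's one-run inventory is a LOCATION only: (2.23)/(2.25)–(2.27) p. 259 of
    [Balaban1988Convergent] (the regular action as a sum over steps `j` and localization domains, with the vacuum-energy
    subtraction `𝐄^{(j)}(Λ_j, g_{j−1}, U_k) − 𝐄^{(j)}(Λ_j, g_{j−1}, 1)`), and [Balaban1989LargeFieldII] (1.98)–(1.102) p. 390,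
    (1.103)–(1.104) p. 391 (print's own index set), as transcribed in the headers of `T4RecentScale`, `T4GoodClassBudget`,
    `T4MatchingClosure`.  Run B's FIRST-STEP factors (its extra, ultraviolet-most step, unmatched under the re-indexing
    `i+1 ↔ i`) are NOT ledger factors: they sit in `o^B`, and their two-run "rate" is a ONE-RUN size at the OLDEST creation
    scale, booked in `RO ≤ vol·rO K` — this is where advisory A13 of the lineage's proof audit (C-t4r3-10: "`URateUpTo K`
    restricts to scale `≤ K`; the top-scale run-B domains must come from elsewhere") is discharged TO A BINDER, not proved.
(S) ONE-RUN SIZE CENTRING per slice, `S ≤ vol·E·a^{K−j}`: the shape of the all-regular part `n = k` of (2.43) p. 263 of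
    [Balaban1988Convergent] (one run; «for β < 1, and sufficiently regular configurations») used one run at a time; the parts
    `n < k` of (2.43) (regions regular only to scale `n`) are NOT in this majorant (`T4GoodClassBudget` §3, GAPS R2).
(M) MULTIPLICITY of scale-`j` domains per unit final volume with base `Λ = L⁴` ((0.26) p. 257 of [Balaban1987RG1] counts
    domains through a cube in ONE run; the two-run ledger version is NOT PRINTED — `T4RecentScale.Multiplicity`).
(O) OTHER KINDS: the R-kind (marginal, `R₁g_j^{κ₀}`-sized, (2.44) p. 263), boundary terms, remnants and run B's unmatched
    step, aggregated in `o`, centred within `RO ≤ vol·rO K` with `Summable rO` — their two-run rates are the sibling routes'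
    (NE7b-rem / `T4RemnantBooking`, `T4BoundaryCarrier` / `T4BoundaryRate`, NE-R1's two-run half = the `uv_*` fields of
    `T4MatchingClosure.ReindexedBudget`), not this one's.
(D) HAZARD H-U5b-1: the term constant `Cc` (size OR rate centre per slice, whichever radius is smaller, plus `cO`) is within
    `vol·s K` of a `t`-free class constant `c₀ K`, `Summable s` (T4-DAG node U5b; NOT PRINTED) — in §3c it is required for
    the centres chosen with the tower's (existentially produced) `Cr`, i.e. in practice uniformly in the rate constant.
(T) THE TOWER INPUTS of §3c themselves (NE9 with fading memory `ω < 1`, the analytic margin behind Lipschitz-in-U and its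
    growth — `T4TowerRateDischarge` §1–§2, where the flow (0.31) = the cell's BetaPertH road enters as a named binder —,
    NE5, NE3 at a GEOMETRIC rate `θ₃^K` — LOAD-BEARING for the `K`-uniform constant (with a merely polynomial NE3 the
    constant grows like `(K+1)^q`, still summable by `…_poly` but a different ledger), node U2's injected rate /
    `EventualLowerH`) — all NOT PRINTED, all explicit.
(W) NE7's WEIGHT HALF `RelWeightBound` and the partial-sum format / positivity of `Z` in `cauchy_of_goodClause` — untouched.
No conditional ((B), (B^μ), BetaPertH) is hidden in a definition: NOTHING is defined in this module; every reading above is a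
`∀`-binder of the theorem that uses it, and the conditionals enter only through the named hypothesis shapes of the imported
modules (`T4TowerRateDischarge` header).

CITATION HEADER (printed context = LOCATIONS only; the quotations are those transcribed verbatim in the headers of the
imported tree modules `T4RecentScale` ((2.23), (2.25)–(2.27) p. 259–260), `T4GoodClassBudget` (Theorem 2, (2.43)–(2.44)
p. 263; [Balaban1989LargeFieldII] (1.98)–(1.101) p. 390), `T4MatchingClosure` ((1.103)–(1.104) p. 391) and
`T4TowerRateDischarge`, which read them from the cell's page store; nothing new is quoted and NO decl below carries a cite
tag — every decl is [folklore]: finite sums and products, `Real.log`/`Real.exp` monotonicity, one Bochner-integral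
monotonicity through `T4HybridMatching.integral_sandwich`, `Summable` algebra).
* [Balaban1988Convergent] T. Bałaban, *Convergent renormalization expansions for lattice gauge theories*, Commun. Math.
  Phys. 119 (1988) 243–285 — (2.25) p. 259 (vacuum-energy subtraction, the shape of the E-factors of §2/§3b), Theorem 2
  (2.43) p. 263 (one-run size of the regular action near large fields; binder (S)).
* [Balaban1989LargeFieldII] T. Bałaban, *Large field renormalization. II*, Commun. Math. Phys. 122 (1989) 355–392 — Thm 1
  p. 355 (ultraviolet stability, the rung BELOW the cell's target), (1.98)–(1.104) pp. 390–391 (print's index set; binder (F)).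
* [Balaban1987RG1] T. Bałaban, *Renormalization group approach to lattice gauge field theories. I*, Commun. Math. Phys. 109
  (1987) 249–301 — (0.26) p. 257 (domain counting; binder (M)).
-/

open Finset MeasureTheory

namespace Literature.MathematicalPhysics.QuantumFieldTheory.Balaban1983to89.T4TermwiseBudget

open T4OutputRate T4RecentScale T4GoodClassBudget T4CauchySum T4TowerRateComposition T4TowerRateDischarge

/-! ## §1 One term: a flat factor ledger with two centrings, the aggregated other kinds, the pending positive integral -/

section OneTerm

variable {ι V : Type*} {Adm : Set V} {fac : Finset ι} {sc : ι → ℕ} {fA fB : ι → V → ℝ} {oA oB : V → ℝ}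
  {κ₁ κ₂ S ρ : ℕ → ℝ} {cO RO : ℝ} {K : ℕ}

/-- **LOG FORM ON THE ADMISSIBLE SET.**  At an admissible driving field `v`: all ledger factors and the aggregated
other-kinds factor positive in both runs; every creation-scale slice `j ≤ K` of `log f^B − log f^A` over the ledger within
the SIZE radius `S j` of a size centre `κ₁ j` AND within the RATE radius `ρ j` of a rate centre `κ₂ j`; the other kinds
within `RO` of `cO` ⇒ the log-ratio of the two runs' DENSITIES is within `Σ_{j ≤ K} min(S j, ρ j) + RO` of the
field-independent constant `Σ_{j ≤ K} sliceCentre κ₁ κ₂ S ρ j + cO` (`T4GoodClassBudget.abs_log_prod_sub_le_crossover`, the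
choice of centring of its §1, composed with the other kinds). [folklore] -/
theorem density_logBound_of_centring (hsc : ∀ i ∈ fac, sc i ≤ K) {v : V}
    (hpos : ∀ i ∈ fac, 0 < fA i v ∧ 0 < fB i v) (hoA : 0 < oA v) (hoB : 0 < oB v)
    (hS : ∀ j ≤ K, |(∑ i ∈ fac with sc i = j, (Real.log (fB i v) - Real.log (fA i v))) - κ₁ j| ≤ S j)
    (hρ : ∀ j ≤ K, |(∑ i ∈ fac with sc i = j, (Real.log (fB i v) - Real.log (fA i v))) - κ₂ j| ≤ ρ j)
    (hO : |Real.log (oB v) - Real.log (oA v) - cO| ≤ RO) :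
    |Real.log ((∏ i ∈ fac, fB i v) * oB v) - Real.log ((∏ i ∈ fac, fA i v) * oA v)
        - ((∑ j ∈ range (K + 1), sliceCentre κ₁ κ₂ S ρ j) + cO)|
      ≤ (∑ j ∈ range (K + 1), min (S j) (ρ j)) + RO := by
  have hsc' : ∀ i ∈ fac, sc i ∈ range (K + 1) := fun i hi => mem_range.mpr (Nat.lt_succ_of_le (hsc i hi))
  have hA : ∀ i ∈ fac, 0 < fA i v := fun i hi => (hpos i hi).1
  have hB : ∀ i ∈ fac, 0 < fB i v := fun i hi => (hpos i hi).2
  have hE := abs_log_prod_sub_le_crossover (κ₁ := κ₁) (κ₂ := κ₂) (S := S) (ρ := ρ) hsc' hA hB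
    (fun j hj => hS j (Nat.le_of_lt_succ (mem_range.mp hj)))
    (fun j hj => hρ j (Nat.le_of_lt_succ (mem_range.mp hj)))
  have hPA : 0 < ∏ i ∈ fac, fA i v := prod_pos hA
  have hPB : 0 < ∏ i ∈ fac, fB i v := prod_pos hB
  rw [Real.log_mul hPB.ne' hoB.ne', Real.log_mul hPA.ne' hoA.ne']
  have e : Real.log (∏ i ∈ fac, fB i v) + Real.log (oB v) - (Real.log (∏ i ∈ fac, fA i v) + Real.log (oA v))
      - ((∑ j ∈ range (K + 1), sliceCentre κ₁ κ₂ S ρ j) + cO)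
      = (Real.log (∏ i ∈ fac, fB i v) - Real.log (∏ i ∈ fac, fA i v)
          - ∑ j ∈ range (K + 1), sliceCentre κ₁ κ₂ S ρ j)
        + (Real.log (oB v) - Real.log (oA v) - cO) := by ring
  rw [e]
  exact (abs_add_le _ _).trans (add_le_add hE hO)

/-- **THE TWO RUNS' DENSITIES ARE SANDWICHED AT EVERY DRIVING FIELD** with the centred constant and the crossover radius:
on the admissible set by `density_logBound_of_centring` and `T4CauchySum.two_sided_of_abs_log_sub_le`; off it both
densities VANISH (a characteristic function identical in the two runs after node U5a's synchronisation — hypothesis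
`hoff`), so every sandwich holds trivially; and the run-A density is nonnegative everywhere. [folklore] -/
theorem density_sandwich_of_centring (hsc : ∀ i ∈ fac, sc i ≤ K)
    (hpos : ∀ v ∈ Adm, (∀ i ∈ fac, 0 < fA i v ∧ 0 < fB i v) ∧ 0 < oA v ∧ 0 < oB v)
    (hoff : ∀ v, v ∉ Adm → (∏ i ∈ fac, fA i v) * oA v = 0 ∧ (∏ i ∈ fac, fB i v) * oB v = 0)
    (hS : ∀ v ∈ Adm, ∀ j ≤ K,
      |(∑ i ∈ fac with sc i = j, (Real.log (fB i v) - Real.log (fA i v))) - κ₁ j| ≤ S j)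
    (hρ : ∀ v ∈ Adm, ∀ j ≤ K,
      |(∑ i ∈ fac with sc i = j, (Real.log (fB i v) - Real.log (fA i v))) - κ₂ j| ≤ ρ j)
    (hO : ∀ v ∈ Adm, |Real.log (oB v) - Real.log (oA v) - cO| ≤ RO) (v : V) :
    0 ≤ (∏ i ∈ fac, fA i v) * oA v ∧
      Real.exp (((∑ j ∈ range (K + 1), sliceCentre κ₁ κ₂ S ρ j) + cO)
          - ((∑ j ∈ range (K + 1), min (S j) (ρ j)) + RO)) * ((∏ i ∈ fac, fA i v) * oA v)
        ≤ (∏ i ∈ fac, fB i v) * oB v ∧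
      (∏ i ∈ fac, fB i v) * oB v
        ≤ Real.exp (((∑ j ∈ range (K + 1), sliceCentre κ₁ κ₂ S ρ j) + cO)
          + ((∑ j ∈ range (K + 1), min (S j) (ρ j)) + RO)) * ((∏ i ∈ fac, fA i v) * oA v) := by
  by_cases hv : v ∈ Adm
  · obtain ⟨hp, hoA, hoB⟩ := hpos v hv
    have hPA : 0 < (∏ i ∈ fac, fA i v) * oA v := mul_pos (prod_pos fun i hi => (hp i hi).1) hoA
    have hPB : 0 < (∏ i ∈ fac, fB i v) * oB v := mul_pos (prod_pos fun i hi => (hp i hi).2) hoB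
    exact ⟨hPA.le, two_sided_of_abs_log_sub_le hPA hPB
      (density_logBound_of_centring hsc hp hoA hoB (hS v hv) (hρ v hv) (hO v hv))⟩
  · obtain ⟨h0A, h0B⟩ := hoff v hv
    rw [h0A, h0B]
    simp

/-- **ONE GOOD TERM** (the pending positive integral, `T4HybridMatching.integral_sandwich`): the two runs' term VALUES
`a = ∫ (∏ f^A)·o^A dμ`, `b = ∫ (∏ f^B)·o^B dμ` satisfy `0 ≤ a` and `e^{Cc − Rr}·a ≤ b ≤ e^{Cc + Rr}·a` with the term's
own centred constant `Cc = Σ_{j ≤ K} sliceCentre κ₁ κ₂ S ρ j + cO` and radius `Rr = Σ_{j ≤ K} min(S j, ρ j) + RO` —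
literally the `nonneg` / `lower` / `upper` fields of `T4GoodClassBudget.TermBudget` for that term. [folklore] -/
theorem term_sandwich_of_centring [MeasurableSpace V] {μ : Measure V} (hsc : ∀ i ∈ fac, sc i ≤ K)
    (hpos : ∀ v ∈ Adm, (∀ i ∈ fac, 0 < fA i v ∧ 0 < fB i v) ∧ 0 < oA v ∧ 0 < oB v)
    (hoff : ∀ v, v ∉ Adm → (∏ i ∈ fac, fA i v) * oA v = 0 ∧ (∏ i ∈ fac, fB i v) * oB v = 0)
    (hS : ∀ v ∈ Adm, ∀ j ≤ K,
      |(∑ i ∈ fac with sc i = j, (Real.log (fB i v) - Real.log (fA i v))) - κ₁ j| ≤ S j)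
    (hρ : ∀ v ∈ Adm, ∀ j ≤ K,
      |(∑ i ∈ fac with sc i = j, (Real.log (fB i v) - Real.log (fA i v))) - κ₂ j| ≤ ρ j)
    (hO : ∀ v ∈ Adm, |Real.log (oB v) - Real.log (oA v) - cO| ≤ RO)
    (hintA : Integrable (fun v => (∏ i ∈ fac, fA i v) * oA v) μ)
    (hintB : Integrable (fun v => (∏ i ∈ fac, fB i v) * oB v) μ) :
    0 ≤ ∫ v, (∏ i ∈ fac, fA i v) * oA v ∂μ ∧
      Real.exp (((∑ j ∈ range (K + 1), sliceCentre κ₁ κ₂ S ρ j) + cO)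
          - ((∑ j ∈ range (K + 1), min (S j) (ρ j)) + RO)) * ∫ v, (∏ i ∈ fac, fA i v) * oA v ∂μ
        ≤ ∫ v, (∏ i ∈ fac, fB i v) * oB v ∂μ ∧
      ∫ v, (∏ i ∈ fac, fB i v) * oB v ∂μ
        ≤ Real.exp (((∑ j ∈ range (K + 1), sliceCentre κ₁ κ₂ S ρ j) + cO)
          + ((∑ j ∈ range (K + 1), min (S j) (ρ j)) + RO)) * ∫ v, (∏ i ∈ fac, fA i v) * oA v ∂μ := by
  have h := density_sandwich_of_centring hsc hpos hoff hS hρ hO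
  obtain ⟨h1, h2⟩ := T4HybridMatching.integral_sandwich hintA hintB
    (Filter.Eventually.of_forall fun v => (h v).2.1) (Filter.Eventually.of_forall fun v => (h v).2.2)
  exact ⟨integral_nonneg fun v => (h v).1, h1, h2⟩

/-- **THE E-BRANCH OF THE CROSSOVER, PER UNIT VOLUME, WITH ANY RATE CONSTANT `Cr ≥ 0`** (the E-branch half of
`T4TowerRateComposition.termRadius_le_crossoverDeltaPoly`, whose `C(K+1)^p` is one admissible `Cr`): per-slice SIZE radii
`S j ≤ vol·E·a^{K−j}` and RATE radii `ρ j ≤ Cw·vol·(Cr θ^j Λ^{K−j})` give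
`Σ_{j ≤ K} min(S j, ρ j) ≤ vol·max(Cw,1)·(E + Cr)·Σ_{j+n=K} min(aⁿ, θ^j Λⁿ)`. [folklore] -/
theorem sliceMin_le_eShape {S ρ : ℕ → ℝ} {vol Cw E a θ Λ Cr : ℝ} {K : ℕ} (hvol : 0 ≤ vol) (hE : 0 ≤ E)
    (ha : 0 ≤ a) (hθ : 0 ≤ θ) (hΛ : 0 ≤ Λ) (hCr : 0 ≤ Cr)
    (hS : ∀ j ≤ K, S j ≤ vol * (E * a ^ (K - j)))
    (hρ : ∀ j ≤ K, ρ j ≤ Cw * vol * (Cr * θ ^ j * Λ ^ (K - j))) :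
    ∑ j ∈ range (K + 1), min (S j) (ρ j)
      ≤ vol * (max Cw 1 * ((E + Cr) * ∑ x ∈ antidiagonal K, min (a ^ x.2) (θ ^ x.1 * Λ ^ x.2))) := by
  set Cv := vol * max Cw 1 with hCv
  have h1v : vol ≤ Cv :=
    calc vol = vol * 1 := (mul_one _).symm
      _ ≤ vol * max Cw 1 := mul_le_mul_of_nonneg_left (le_max_right _ _) hvol
  have hCwv : Cw * vol ≤ Cv := by
    rw [hCv, mul_comm Cw]
    exact mul_le_mul_of_nonneg_left (le_max_left _ _) hvol
  have hCv0 : 0 ≤ Cv := mul_nonneg hvol (zero_le_one.trans (le_max_right _ _))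
  have hrate0 : ∀ j, 0 ≤ Cr * θ ^ j * Λ ^ (K - j) := fun j =>
    mul_nonneg (mul_nonneg hCr (pow_nonneg hθ _)) (pow_nonneg hΛ _)
  have hS' : ∀ j ≤ K, S j ≤ Cv * (E * a ^ (K - j)) := fun j hj =>
    (hS j hj).trans (mul_le_mul_of_nonneg_right h1v (mul_nonneg hE (pow_nonneg ha _)))
  have hρ' : ∀ j ≤ K, ρ j ≤ Cv * (Cr * θ ^ j * Λ ^ (K - j)) := fun j hj =>
    (hρ j hj).trans (mul_le_mul_of_nonneg_right hCwv (hrate0 j))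
  have hsum := sum_min_le_crossoverShape (SZ := fun j => E * a ^ (K - j)) hS' hρ'
  have hbr : ∑ x ∈ antidiagonal K, min (E * a ^ (K - x.1)) (Cr * θ ^ x.1 * Λ ^ x.2)
      ≤ (E + Cr) * ∑ x ∈ antidiagonal K, min (a ^ x.2) (θ ^ x.1 * Λ ^ x.2) := by
    refine sum_min_le_eBranch (SZ := fun j => E * a ^ (K - j)) (add_nonneg hE hCr) hθ hΛ (by linarith)
      fun x hx => ?_
    have hx' : K - x.1 = x.2 := by have := mem_antidiagonal.mp hx; omega
    show E * a ^ (K - x.1) ≤ (E + Cr) * a ^ x.2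
    rw [hx']
    exact mul_le_mul_of_nonneg_right (by linarith) (pow_nonneg ha _)
  calc ∑ j ∈ range (K + 1), min (S j) (ρ j)
      ≤ Cv * ∑ x ∈ antidiagonal K, min (E * a ^ (K - x.1)) (Cr * θ ^ x.1 * Λ ^ x.2) := hsum
    _ ≤ Cv * ((E + Cr) * ∑ x ∈ antidiagonal K, min (a ^ x.2) (θ ^ x.1 * Λ ^ x.2)) :=
        mul_le_mul_of_nonneg_left hbr hCv0
    _ = vol * (max Cw 1 * ((E + Cr) * ∑ x ∈ antidiagonal K, min (a ^ x.2) (θ ^ x.1 * Λ ^ x.2))) := by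
        rw [hCv]; ring

end OneTerm

/-! ## §2 The RATE slice from the term-wise tower: `URateUpTo K` under multiplicity -/

section TowerSlice

variable {C : Carriers} {V : Type*}

/-- **THE RATE CENTRING OF THE E-GROUP FROM THE COMPOSED TOWER RATE.**  Under `URateUpTo K` (lineage t4-ne7-p1: the
composed two-run rate of node U3 up to cutoff `K`, constant `E₀′`, rate `θ`; NOT PRINTED) the (2.25)-shaped E-factors
`f_X(v) = exp(E(X; g, U(v)) − E(X; g, U₁))` of a cutoff-`K` ledger `fac` obey `T4RecentScale.FactorLogRatio`
(`T4TowerRateComposition.factorLogRatio_smallFieldE_upTo`); `T4GoodClassBudget.rate_centring` sums a scale slice against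
the rate centre `κ₂ j = Σ_{scale X = j} c_X`, `c_X = −(E^B(X; g^B, U₁^B) − E^A(X; g^A, U₁^A))`, and multiplicity of scale-`j`
domains per unit final volume (`T4RecentScale.Multiplicity`, NOT PRINTED for a two-run ledger) bounds the slice's rate radius
by `Cw·vol·(E₀′ θ^j Λ^{K−j})` (`T4TowerRateComposition.rateSlice_le`). [folklore] -/
theorem rateSlice_of_uRateUpTo {EA : Functional C C.BgA} {EB : Functional C C.BgB} {gA gB : ℕ → ℝ} {uA : V → C.BgA}
    {uB : V → C.BgB} {Adm : Set V} {E₀' θ κ Cw vol Λ : ℝ} {K : ℕ} (h : URateUpTo K EA EB gA gB uA uB Adm E₀' θ κ)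
    (oneA : C.BgA) (oneB : C.BgB) {fac : Finset C.Dom} (hfac : ∀ X ∈ fac, C.scale X ≤ K)
    (hM : Multiplicity fac C.scale (fun X => Real.exp (-(κ * C.d X))) Cw vol Λ K) (hE : 0 ≤ E₀') (hθ : 0 ≤ θ)
    {v : V} (hv : v ∈ Adm) {j : ℕ} (hj : j ≤ K) :
    |(∑ X ∈ fac with C.scale X = j,
        (Real.log (Real.exp (EB gB (uB v) X - EB gB oneB X)) - Real.log (Real.exp (EA gA (uA v) X - EA gA oneA X))))
      - ∑ X ∈ fac with C.scale X = j, (-(EB gB oneB X - EA gA oneA X))|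
      ≤ Cw * vol * (E₀' * θ ^ j * Λ ^ (K - j)) := by
  have hF := factorLogRatio_smallFieldE_upTo h oneA oneB fac hfac (fun _ => E₀') rfl
  have hfw : ∀ X ∈ fac, |Real.log (Real.exp (EB gB (uB v) X - EB gB oneB X))
      - Real.log (Real.exp (EA gA (uA v) X - EA gA oneA X)) - (-(EB gB oneB X - EA gA oneA X))|
      ≤ E₀' * θ ^ C.scale X * Real.exp (-(κ * C.d X)) := fun X hX => by
    have h3 := (hF v hv X hX).2.2
    simpa only [recentProfile, add_zero] using h3
  exact (rate_centring (fA := fun X v => Real.exp (EA gA (uA v) X - EA gA oneA X))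
    (fB := fun X v => Real.exp (EB gB (uB v) X - EB gB oneB X)) (sc := C.scale)
    (c := fun X => -(EB gB oneB X - EA gA oneA X)) (r := fun X => E₀' * θ ^ C.scale X * Real.exp (-(κ * C.d X)))
    j hfw).trans (rateSlice_le hM hE hθ hj)

end TowerSlice

/-! ## §3 The family: `T4GoodClassBudget.TermBudget` from the ledger binders, and the good clause with `Summable δ` -/

section Family

variable {ι F V : Type*} [DecidableEq ι] [MeasurableSpace V] {l₀ vol : ℝ} {T : ℕ → Finset ι}
  {Bad : ℕ → ℝ → Finset ι} {A B : ℕ → ℝ → ι → ℝ} {μ : ℕ → ℝ → ι → Measure V} {Adm : ℕ → ℝ → ι → Set V}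
  {fac : ℕ → ℝ → ι → Finset F} {sc : F → ℕ} {fA fB : ℕ → ℝ → ι → F → V → ℝ} {oA oB : ℕ → ℝ → ι → V → ℝ}
  {κ₁ κ₂ S ρ : ℕ → ℝ → ι → ℕ → ℝ} {cO RO : ℕ → ℝ → ι → ℝ} {c₀ s rO Cr : ℕ → ℝ} {Cw E a θ Λ : ℝ}

/-- **THE PER-TERM BUDGET OF NODE U5 BUILT FROM A FLAT LEDGER** (obligation O-b2 of `T4MatchingClosure` /
`T4GoodClassBudget` §5, for the TERM-WISE profile).  HYPOTHESES (binders; NONE printed as a two-run statement; nothing of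
Bałaban's expansions is asserted): TERM FORMAT — every good term's two values are pending positive integrals
`A = ∫ (∏_{fac} f^A)·o^A dμ_{K,t,τ}`, `B = ∫ (∏_{fac} f^B)·o^B dμ_{K,t,τ}` over a common measurable space of driving fields,
the ledger `fac K t τ` holding the E-group factors (creation scales `sc ≤ K`) and `o^{A/B}` the aggregated other kinds,
all positive on the admissible set and the densities vanishing off it, integrable; per slice a ONE-RUN SIZE centring
(`κ₁`, `S`; shape of (2.43) p. 263 of [Balaban1988Convergent] with `n = k`, used one run at a time — a LOCATION, not a
citation) with `S ≤ vol·E·a^{K−j}`, and a TWO-RUN RATE centring (`κ₂`, `ρ`; §2 produces it from `URateUpTo K`) with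
`ρ ≤ Cw·vol·(Cr_K θ^j Λ^{K−j})`; the other kinds centred at `cO` within `RO ≤ vol·rO_K`; and hazard H-U5b-1 ON THE CHOSEN
CENTRES: the term constant `Σ_j sliceCentre … j + cO` deviates from a t-free class constant `c₀ K` by at most `vol·s_K`.
CONCLUSION: `TermBudget` with these explicit `Cc`, `Rr` and remainder rate
`r K = max(Cw,1)·(E + Cr_K)·Σ_{j+n=K} min(aⁿ, θ^jΛⁿ) + rO K`. [folklore] -/
theorem termBudget_of_ledger
    (hfmtA : ∀ K t τ, A K t τ = ∫ v, (∏ i ∈ fac K t τ, fA K t τ i v) * oA K t τ v ∂(μ K t τ))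
    (hfmtB : ∀ K t τ, B K t τ = ∫ v, (∏ i ∈ fac K t τ, fB K t τ i v) * oB K t τ v ∂(μ K t τ))
    (hint : ∀ K t, |t| ≤ l₀ → ∀ τ ∈ T K \ Bad K t,
      Integrable (fun v => (∏ i ∈ fac K t τ, fA K t τ i v) * oA K t τ v) (μ K t τ) ∧
        Integrable (fun v => (∏ i ∈ fac K t τ, fB K t τ i v) * oB K t τ v) (μ K t τ))
    (hsc : ∀ K t, |t| ≤ l₀ → ∀ τ ∈ T K \ Bad K t, ∀ i ∈ fac K t τ, sc i ≤ K)
    (hpos : ∀ K t, |t| ≤ l₀ → ∀ τ ∈ T K \ Bad K t, ∀ v ∈ Adm K t τ,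
      (∀ i ∈ fac K t τ, 0 < fA K t τ i v ∧ 0 < fB K t τ i v) ∧ 0 < oA K t τ v ∧ 0 < oB K t τ v)
    (hoff : ∀ K t, |t| ≤ l₀ → ∀ τ ∈ T K \ Bad K t, ∀ v, v ∉ Adm K t τ →
      (∏ i ∈ fac K t τ, fA K t τ i v) * oA K t τ v = 0 ∧ (∏ i ∈ fac K t τ, fB K t τ i v) * oB K t τ v = 0)
    (hS : ∀ K t, |t| ≤ l₀ → ∀ τ ∈ T K \ Bad K t, ∀ v ∈ Adm K t τ, ∀ j ≤ K,
      |(∑ i ∈ fac K t τ with sc i = j, (Real.log (fB K t τ i v) - Real.log (fA K t τ i v))) - κ₁ K t τ j|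
        ≤ S K t τ j)
    (hρ : ∀ K t, |t| ≤ l₀ → ∀ τ ∈ T K \ Bad K t, ∀ v ∈ Adm K t τ, ∀ j ≤ K,
      |(∑ i ∈ fac K t τ with sc i = j, (Real.log (fB K t τ i v) - Real.log (fA K t τ i v))) - κ₂ K t τ j|
        ≤ ρ K t τ j)
    (hO : ∀ K t, |t| ≤ l₀ → ∀ τ ∈ T K \ Bad K t, ∀ v ∈ Adm K t τ,
      |Real.log (oB K t τ v) - Real.log (oA K t τ v) - cO K t τ| ≤ RO K t τ)
    (hvol : 0 ≤ vol) (hE : 0 ≤ E) (ha : 0 ≤ a) (hθ : 0 ≤ θ) (hΛ : 0 ≤ Λ) (hCr : ∀ K, 0 ≤ Cr K)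
    (hSle : ∀ K t, |t| ≤ l₀ → ∀ τ ∈ T K \ Bad K t, ∀ j ≤ K, S K t τ j ≤ vol * (E * a ^ (K - j)))
    (hρle : ∀ K t, |t| ≤ l₀ → ∀ τ ∈ T K \ Bad K t, ∀ j ≤ K,
      ρ K t τ j ≤ Cw * vol * (Cr K * θ ^ j * Λ ^ (K - j)))
    (hRO : ∀ K t, |t| ≤ l₀ → ∀ τ ∈ T K \ Bad K t, RO K t τ ≤ vol * rO K)
    (hdev : ∀ K t, |t| ≤ l₀ → ∀ τ ∈ T K \ Bad K t,
      |((∑ j ∈ range (K + 1), sliceCentre (κ₁ K t τ) (κ₂ K t τ) (S K t τ) (ρ K t τ) j) + cO K t τ) - c₀ K|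
        ≤ vol * s K) :
    TermBudget l₀ vol T A B Bad
      (fun K t τ => (∑ j ∈ range (K + 1), sliceCentre (κ₁ K t τ) (κ₂ K t τ) (S K t τ) (ρ K t τ) j) + cO K t τ)
      (fun K t τ => (∑ j ∈ range (K + 1), min (S K t τ j) (ρ K t τ j)) + RO K t τ) c₀
      (fun K => max Cw 1 * ((E + Cr K) * ∑ x ∈ antidiagonal K, min (a ^ x.2) (θ ^ x.1 * Λ ^ x.2)) + rO K) s where
  nonneg K t ht τ hτ := by
    rw [hfmtA]
    exact (term_sandwich_of_centring (hsc K t ht τ hτ) (hpos K t ht τ hτ) (hoff K t ht τ hτ) (hS K t ht τ hτ)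
      (hρ K t ht τ hτ) (hO K t ht τ hτ) (hint K t ht τ hτ).1 (hint K t ht τ hτ).2).1
  lower K t ht τ hτ := by
    rw [hfmtA, hfmtB]
    exact (term_sandwich_of_centring (hsc K t ht τ hτ) (hpos K t ht τ hτ) (hoff K t ht τ hτ) (hS K t ht τ hτ)
      (hρ K t ht τ hτ) (hO K t ht τ hτ) (hint K t ht τ hτ).1 (hint K t ht τ hτ).2).2.1
  upper K t ht τ hτ := by
    rw [hfmtA, hfmtB]
    exact (term_sandwich_of_centring (hsc K t ht τ hτ) (hpos K t ht τ hτ) (hoff K t ht τ hτ) (hS K t ht τ hτ)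
      (hρ K t ht τ hτ) (hO K t ht τ hτ) (hint K t ht τ hτ).1 (hint K t ht τ hτ).2).2.2
  remainder K t ht τ hτ := by
    have h1 := sliceMin_le_eShape hvol hE ha hθ hΛ (hCr K) (hSle K t ht τ hτ) (hρle K t ht τ hτ)
    have h2 := hRO K t ht τ hτ
    show (∑ j ∈ range (K + 1), min (S K t τ j) (ρ K t τ j)) + RO K t τ
      ≤ vol * (max Cw 1 * ((E + Cr K) * ∑ x ∈ antidiagonal K, min (a ^ x.2) (θ ^ x.1 * Λ ^ x.2)) + rO K)
    rw [mul_add]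
    exact add_le_add h1 h2
  deviation K t ht τ hτ := hdev K t ht τ hτ

/-- **THE GOOD CLAUSE WITH `Summable δ` FROM THE LEDGER BUDGET** (both inputs `hgood`, `hδ` of
`T4GoodClassBudget.cauchy_of_goodClause`; its third input, the weight budget `RelWeightBound`, is NE7's other half and not
this route's): `δ = r + s` with `r` as in `termBudget_of_ledger`, summable when the E-branch `(E + Cr_K)·Σ min(aⁿ, θ^jΛⁿ)`
is (for `Cr_K = C(K+1)^p`: `T4TowerRateComposition.summable_eBranch_poly`) and the other kinds' `rO`, the deviations `s` are
(binders). [folklore] -/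
theorem goodClause_summable_of_ledgerBudget {Cc Rr : ℕ → ℝ → ι → ℝ}
    (hT : TermBudget l₀ vol T A B Bad Cc Rr c₀
      (fun K => max Cw 1 * ((E + Cr K) * ∑ x ∈ antidiagonal K, min (a ^ x.2) (θ ^ x.1 * Λ ^ x.2)) + rO K) s)
    (hsum : Summable (fun K => (E + Cr K) * ∑ x ∈ antidiagonal K, min (a ^ x.2) (θ ^ x.1 * Λ ^ x.2)))
    (hrO : Summable rO) (hs : Summable s) :
    GoodClause l₀ vol T A B Bad
        (fun K => (max Cw 1 * ((E + Cr K) * ∑ x ∈ antidiagonal K, min (a ^ x.2) (θ ^ x.1 * Λ ^ x.2)) + rO K)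
          + s K) ∧
      Summable (fun K => (max Cw 1 * ((E + Cr K) * ∑ x ∈ antidiagonal K, min (a ^ x.2) (θ ^ x.1 * Λ ^ x.2))
          + rO K) + s K) :=
  ⟨goodClause_of_termBudget hT, ((hsum.mul_left (max Cw 1)).add hrO).add hs⟩

/-- The polynomial rate constant of the term-wise tower (`T4TowerRateComposition` §4–§5: `Cr_K = C·(K+1)^p`, `p = 1` from
`uRateUpTo_tower_linear`, `p = 0` from `T4TowerRateDischarge.uRateUpTo_tower_anyRate`) makes the E-branch summable for
`0 < a < 1`, `0 < θ < 1`, `θ ≤ Λ` (`summable_eBranch_poly`). [folklore] -/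
theorem goodClause_summable_of_ledgerBudget_poly {Cc Rr : ℕ → ℝ → ι → ℝ} {Cr₀ : ℝ} {p : ℕ}
    (hT : TermBudget l₀ vol T A B Bad Cc Rr c₀
      (fun K => max Cw 1 * ((E + Cr₀ * ((K : ℝ) + 1) ^ p) *
        ∑ x ∈ antidiagonal K, min (a ^ x.2) (θ ^ x.1 * Λ ^ x.2)) + rO K) s)
    (hE : 0 ≤ E) (hCr₀ : 0 ≤ Cr₀) (ha0 : 0 < a) (ha1 : a < 1) (hθ0 : 0 < θ) (hθ1 : θ < 1) (hθΛ : θ ≤ Λ)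
    (hrO : Summable rO) (hs : Summable s) :
    GoodClause l₀ vol T A B Bad
        (fun K => (max Cw 1 * ((E + Cr₀ * ((K : ℝ) + 1) ^ p) *
          ∑ x ∈ antidiagonal K, min (a ^ x.2) (θ ^ x.1 * Λ ^ x.2)) + rO K) + s K) ∧
      Summable (fun K : ℕ => (max Cw 1 * ((E + Cr₀ * ((K : ℝ) + 1) ^ p) *
          ∑ x ∈ antidiagonal K, min (a ^ x.2) (θ ^ x.1 * Λ ^ x.2)) + rO K) + s K) :=
  goodClause_summable_of_ledgerBudget (Cr := fun K : ℕ => Cr₀ * ((K : ℝ) + 1) ^ p) hT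
    (summable_eBranch_poly hE hCr₀ ha0 ha1 hθ0 hθ1 hθΛ) hrO hs

end Family

/-! ## §3b The family FED BY THE TOWER: the E-group in the (2.25) shape, its rate centring produced by §2 -/

section TowerFamily

variable {C : Carriers} {ι V : Type*} [DecidableEq ι] [MeasurableSpace V] {l₀ vol : ℝ} {T : ℕ → Finset ι}
  {Bad : ℕ → ℝ → Finset ι} {A B : ℕ → ℝ → ι → ℝ} {μ : ℕ → ℝ → ι → Measure V} {Adm : ℕ → ℝ → ι → Set V}
  {fac : ℕ → ℝ → ι → Finset C.Dom} {EA : Functional C C.BgA} {EB : Functional C C.BgB} {gA gB : ℕ → ℕ → ℝ}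
  {uA : ℕ → ℝ → ι → V → C.BgA} {uB : ℕ → ℝ → ι → V → C.BgB} {oneA : C.BgA} {oneB : C.BgB}
  {oA oB : ℕ → ℝ → ι → V → ℝ} {κ₁ S : ℕ → ℝ → ι → ℕ → ℝ} {cO RO : ℕ → ℝ → ι → ℝ} {c₀ s rO Cr : ℕ → ℝ}
  {Cw E a θ κ Λ : ℝ}

/-- **NODE U5's PER-TERM BUDGET FED BY THE TERM-WISE TOWER RATE.**  As `termBudget_of_ledger`, with the E-group factors in
the (2.25) shape `f_X(v) = exp(E(X; g_K, U_{K,t,τ}(v)) − E(X; g_K, U₁))` (p. 259 of [Balaban1988Convergent] — a LOCATION for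
the vacuum-energy subtraction; run B re-indexed, `g^B_K = (i ↦ g_{K+1,i+1})` in the lineage's convention), their creation
scale `C.scale`, weight `e^{−κ d(X)}`; the RATE centring is no longer a binder: `URateUpTo K` along each good term's
driving-field family (`hU`, the lineage's composed tower rate with constant `Cr K`, NOT PRINTED) and `Multiplicity` of the
term's ledger (`hM`, NOT PRINTED) produce it by `rateSlice_of_uRateUpTo`, with rate centre
`κ₂ j = Σ_{scale X = j} −(E^B(X; g^B_K, U₁^B) − E^A(X; g^A_K, U₁^A))` and radius `Cw·vol·(Cr_K θ^j Λ^{K−j})` on the nose.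
[folklore] -/
theorem termBudget_of_towerRate
    (hfmtA : ∀ K t τ, A K t τ = ∫ v, (∏ X ∈ fac K t τ,
      Real.exp (EA (gA K) (uA K t τ v) X - EA (gA K) oneA X)) * oA K t τ v ∂(μ K t τ))
    (hfmtB : ∀ K t τ, B K t τ = ∫ v, (∏ X ∈ fac K t τ,
      Real.exp (EB (gB K) (uB K t τ v) X - EB (gB K) oneB X)) * oB K t τ v ∂(μ K t τ))
    (hint : ∀ K t, |t| ≤ l₀ → ∀ τ ∈ T K \ Bad K t,
      Integrable (fun v => (∏ X ∈ fac K t τ, Real.exp (EA (gA K) (uA K t τ v) X - EA (gA K) oneA X)) *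
        oA K t τ v) (μ K t τ) ∧
      Integrable (fun v => (∏ X ∈ fac K t τ, Real.exp (EB (gB K) (uB K t τ v) X - EB (gB K) oneB X)) *
        oB K t τ v) (μ K t τ))
    (hsc : ∀ K t, |t| ≤ l₀ → ∀ τ ∈ T K \ Bad K t, ∀ X ∈ fac K t τ, C.scale X ≤ K)
    (hposO : ∀ K t, |t| ≤ l₀ → ∀ τ ∈ T K \ Bad K t, ∀ v ∈ Adm K t τ, 0 < oA K t τ v ∧ 0 < oB K t τ v)
    (hoff : ∀ K t, |t| ≤ l₀ → ∀ τ ∈ T K \ Bad K t, ∀ v, v ∉ Adm K t τ →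
      (∏ X ∈ fac K t τ, Real.exp (EA (gA K) (uA K t τ v) X - EA (gA K) oneA X)) * oA K t τ v = 0 ∧
      (∏ X ∈ fac K t τ, Real.exp (EB (gB K) (uB K t τ v) X - EB (gB K) oneB X)) * oB K t τ v = 0)
    (hS : ∀ K t, |t| ≤ l₀ → ∀ τ ∈ T K \ Bad K t, ∀ v ∈ Adm K t τ, ∀ j ≤ K,
      |(∑ X ∈ fac K t τ with C.scale X = j,
          (Real.log (Real.exp (EB (gB K) (uB K t τ v) X - EB (gB K) oneB X))
            - Real.log (Real.exp (EA (gA K) (uA K t τ v) X - EA (gA K) oneA X)))) - κ₁ K t τ j| ≤ S K t τ j)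
    (hU : ∀ K t, |t| ≤ l₀ → ∀ τ ∈ T K \ Bad K t,
      URateUpTo K EA EB (gA K) (gB K) (uA K t τ) (uB K t τ) (Adm K t τ) (Cr K) θ κ)
    (hM : ∀ K t, |t| ≤ l₀ → ∀ τ ∈ T K \ Bad K t,
      Multiplicity (fac K t τ) C.scale (fun X => Real.exp (-(κ * C.d X))) Cw vol Λ K)
    (hO : ∀ K t, |t| ≤ l₀ → ∀ τ ∈ T K \ Bad K t, ∀ v ∈ Adm K t τ,
      |Real.log (oB K t τ v) - Real.log (oA K t τ v) - cO K t τ| ≤ RO K t τ)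
    (hvol : 0 ≤ vol) (hE : 0 ≤ E) (ha : 0 ≤ a) (hθ : 0 ≤ θ) (hΛ : 0 ≤ Λ) (hCr : ∀ K, 0 ≤ Cr K)
    (hSle : ∀ K t, |t| ≤ l₀ → ∀ τ ∈ T K \ Bad K t, ∀ j ≤ K, S K t τ j ≤ vol * (E * a ^ (K - j)))
    (hRO : ∀ K t, |t| ≤ l₀ → ∀ τ ∈ T K \ Bad K t, RO K t τ ≤ vol * rO K)
    (hdev : ∀ K t, |t| ≤ l₀ → ∀ τ ∈ T K \ Bad K t,
      |((∑ j ∈ range (K + 1), sliceCentre (κ₁ K t τ)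
          (fun j => ∑ X ∈ fac K t τ with C.scale X = j, (-(EB (gB K) oneB X - EA (gA K) oneA X)))
          (S K t τ) (fun j => Cw * vol * (Cr K * θ ^ j * Λ ^ (K - j))) j) + cO K t τ) - c₀ K| ≤ vol * s K) :
    TermBudget l₀ vol T A B Bad
      (fun K t τ => (∑ j ∈ range (K + 1), sliceCentre (κ₁ K t τ)
          (fun j => ∑ X ∈ fac K t τ with C.scale X = j, (-(EB (gB K) oneB X - EA (gA K) oneA X)))
          (S K t τ) (fun j => Cw * vol * (Cr K * θ ^ j * Λ ^ (K - j))) j) + cO K t τ)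
      (fun K t τ => (∑ j ∈ range (K + 1), min (S K t τ j) (Cw * vol * (Cr K * θ ^ j * Λ ^ (K - j)))) + RO K t τ)
      c₀ (fun K => max Cw 1 * ((E + Cr K) * ∑ x ∈ antidiagonal K, min (a ^ x.2) (θ ^ x.1 * Λ ^ x.2)) + rO K) s :=
  termBudget_of_ledger (sc := C.scale)
    (fA := fun K t τ X v => Real.exp (EA (gA K) (uA K t τ v) X - EA (gA K) oneA X))
    (fB := fun K t τ X v => Real.exp (EB (gB K) (uB K t τ v) X - EB (gB K) oneB X))
    (κ₂ := fun K t τ j => ∑ X ∈ fac K t τ with C.scale X = j, (-(EB (gB K) oneB X - EA (gA K) oneA X)))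
    (ρ := fun K _ _ j => Cw * vol * (Cr K * θ ^ j * Λ ^ (K - j)))
    hfmtA hfmtB hint hsc
    (fun K t ht τ hτ v hv => ⟨fun _ _ => ⟨Real.exp_pos _, Real.exp_pos _⟩, hposO K t ht τ hτ v hv⟩)
    hoff hS
    (fun K t ht τ hτ _ hv _ hj =>
      rateSlice_of_uRateUpTo (hU K t ht τ hτ) oneA oneB (hsc K t ht τ hτ) (hM K t ht τ hτ) (hCr K) hθ hv hj)
    hO hvol hE ha hθ hΛ hCr hSle (fun _ _ _ _ _ _ _ => le_rfl) hRO hdev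

end TowerFamily

/-! ## §3c End to end: the sibling nodes' typed outputs ⇒ node U5's good-class half with `Summable δ`, modulo the
named non-tower binders (format, one-run sizes, multiplicity, other kinds, H-U5b-1, and NE7's weight half elsewhere) -/

section Spine

open T4EtaRateMin (Readings LocalRate)
open T4RateLiaison (GaugeDominated)

variable {C : Carriers} {ι X : Type} [MeasurableSpace ι] {σ : Type*} [DecidableEq σ] {l₀ vol : ℝ}
  {T : ℕ → Finset σ} {Bad : ℕ → ℝ → Finset σ} {A B : ℕ → ℝ → σ → ℝ} {μ : ℕ → ℝ → σ → Measure ι}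
  {fac : ℕ → ℝ → σ → Finset C.Dom} {R : Readings ι X} {W : Set (ℕ → ℝ)} {EA : Functional C C.BgA}
  {EB : Functional C C.BgB} {κ θ₅ C₅ C₉ ω θc Cd γ C₃ θ₃ P θ' : ℝ} {q : ℕ} {Λm : ℕ → ℕ → ℝ}
  {CU : (ℕ → ℝ) → ℕ → ℝ} {g : ℕ → ℕ → ℝ} {uA : ℕ → ι → C.BgA} {uB : ℕ → ι → C.BgB} {oneA : C.BgA} {oneB : C.BgB}
  {oA oB : ℕ → ℝ → σ → ι → ℝ} {κ₁ S : ℕ → ℝ → σ → ℕ → ℝ} {cO RO : ℕ → ℝ → σ → ℝ} {rO : ℕ → ℝ} {Cw E a Λ : ℝ}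

/-- **THE TERM-WISE ROUTE, END TO END (lineage t4-ne7-p1, gens 1–3).**  INPUTS BY NAME, none printed as a two-run statement:
the sibling nodes' typed outputs exactly as in `T4TowerRateDischarge.uRateUpTo_of_nodes` (NE9 + fading memory with moduli
`Λm`, Lipschitz-in-the-background with polynomial growth, NE5, NE3 as `LocalRate` + the liaison `GaugeDominated`, node U2's
injected coupling rate on the printed box, both runs' couplings in the window); the TERM FORMAT of §3b read along node NE3's
reading family (`uA K`, `uB K` on `R.dom` — every good term's E-factors evaluated on the SAME backgrounds-of-the-field maps,
the case the node outputs cover); one-run SIZE centrings; multiplicity with base `Λ`; the other kinds (`rO`).  OUTPUT: a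
rate constant `Cr ≥ 0` (the tower's, `K`-uniform) such that, GRANTED hazard H-U5b-1 on the centres chosen with that `Cr`
(`hdev`, deviations `s`), the per-term budget of node U5 holds with remainder rate
`max(Cw,1)·(E + Cr)·Σ_{j+n=K} min(aⁿ, θ′^jΛⁿ) + rO K` — whence (next theorem) the good clause with `Summable δ`.  What this
does NOT deliver: the weight half `RelWeightBound` of NE7 (sibling seats P2/P3, ne7b/ne7c), the R-kind two-run rate inside
`rO`, the deviation rate `s` (H-U5b-1), the format / size / multiplicity binders themselves. [folklore] -/
theorem termBudget_of_nodes
    (h9 : NE9 EA W κ Λm) (hΛm : FadingMemory C₉ ω Λm) (hω : 0 ≤ ω)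
    (hUL : LipBackground EA W κ CU) (hG : PolyLipGrowth CU g P q) (hP : 0 ≤ P)
    (h5 : NE5 EA EB W κ θ₅ C₅) (hθ₅ : 0 ≤ θ₅) (hC₅ : 0 ≤ C₅)
    (hloc : LocalRate R C₃ θ₃) (hC₃ : 0 ≤ C₃) (hθ₃ : 0 ≤ θ₃) (hθ₃1 : θ₃ < 1) (hgd : GaugeDominated R uA uB)
    (hinj : InjectedRate Cd 0 θc (fun K j => T4CouplingMatching.disc (g K) (g (K + 1)) j)) (hCd : 0 ≤ Cd)
    (hθc : 0 ≤ θc) (hbox : ∀ K i, i ≤ K → 0 < g K i ∧ g K i ≤ γ)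
    (hgA : ∀ K, g K ∈ W) (hgB : ∀ K, (fun i => g (K + 1) (i + 1)) ∈ W)
    (hθ' : max ω θc < θ') (hθ₅' : θ₅ ≤ θ') (hθ₃' : θ₃ ≤ θ')
    (hfmtA : ∀ K t τ, A K t τ = ∫ v, (∏ X ∈ fac K t τ,
      Real.exp (EA (g K) (uA K v) X - EA (g K) oneA X)) * oA K t τ v ∂(μ K t τ))
    (hfmtB : ∀ K t τ, B K t τ = ∫ v, (∏ X ∈ fac K t τ,
      Real.exp (EB (fun i => g (K + 1) (i + 1)) (uB K v) X - EB (fun i => g (K + 1) (i + 1)) oneB X)) *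
        oB K t τ v ∂(μ K t τ))
    (hint : ∀ K t, |t| ≤ l₀ → ∀ τ ∈ T K \ Bad K t,
      Integrable (fun v => (∏ X ∈ fac K t τ, Real.exp (EA (g K) (uA K v) X - EA (g K) oneA X)) *
        oA K t τ v) (μ K t τ) ∧
      Integrable (fun v => (∏ X ∈ fac K t τ,
        Real.exp (EB (fun i => g (K + 1) (i + 1)) (uB K v) X - EB (fun i => g (K + 1) (i + 1)) oneB X)) *
        oB K t τ v) (μ K t τ))
    (hsc : ∀ K t, |t| ≤ l₀ → ∀ τ ∈ T K \ Bad K t, ∀ X ∈ fac K t τ, C.scale X ≤ K)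
    (hposO : ∀ K t, |t| ≤ l₀ → ∀ τ ∈ T K \ Bad K t, ∀ v ∈ R.dom, 0 < oA K t τ v ∧ 0 < oB K t τ v)
    (hoff : ∀ K t, |t| ≤ l₀ → ∀ τ ∈ T K \ Bad K t, ∀ v, v ∉ R.dom →
      (∏ X ∈ fac K t τ, Real.exp (EA (g K) (uA K v) X - EA (g K) oneA X)) * oA K t τ v = 0 ∧
      (∏ X ∈ fac K t τ,
        Real.exp (EB (fun i => g (K + 1) (i + 1)) (uB K v) X - EB (fun i => g (K + 1) (i + 1)) oneB X)) *
        oB K t τ v = 0)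
    (hS : ∀ K t, |t| ≤ l₀ → ∀ τ ∈ T K \ Bad K t, ∀ v ∈ R.dom, ∀ j ≤ K,
      |(∑ X ∈ fac K t τ with C.scale X = j,
          (Real.log (Real.exp (EB (fun i => g (K + 1) (i + 1)) (uB K v) X
              - EB (fun i => g (K + 1) (i + 1)) oneB X))
            - Real.log (Real.exp (EA (g K) (uA K v) X - EA (g K) oneA X)))) - κ₁ K t τ j| ≤ S K t τ j)
    (hM : ∀ K t, |t| ≤ l₀ → ∀ τ ∈ T K \ Bad K t,
      Multiplicity (fac K t τ) C.scale (fun X => Real.exp (-(κ * C.d X))) Cw vol Λ K)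
    (hO : ∀ K t, |t| ≤ l₀ → ∀ τ ∈ T K \ Bad K t, ∀ v ∈ R.dom,
      |Real.log (oB K t τ v) - Real.log (oA K t τ v) - cO K t τ| ≤ RO K t τ)
    (hvol : 0 ≤ vol) (hE : 0 ≤ E) (ha : 0 ≤ a) (hΛ : 0 ≤ Λ)
    (hSle : ∀ K t, |t| ≤ l₀ → ∀ τ ∈ T K \ Bad K t, ∀ j ≤ K, S K t τ j ≤ vol * (E * a ^ (K - j)))
    (hRO : ∀ K t, |t| ≤ l₀ → ∀ τ ∈ T K \ Bad K t, RO K t τ ≤ vol * rO K) :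
    ∃ Cr : ℝ, 0 ≤ Cr ∧ ∀ c₀ s : ℕ → ℝ,
      (∀ K t, |t| ≤ l₀ → ∀ τ ∈ T K \ Bad K t,
        |((∑ j ∈ range (K + 1), sliceCentre (κ₁ K t τ)
            (fun j => ∑ X ∈ fac K t τ with C.scale X = j,
              (-(EB (fun i => g (K + 1) (i + 1)) oneB X - EA (g K) oneA X)))
            (S K t τ) (fun j => Cw * vol * (Cr * θ' ^ j * Λ ^ (K - j))) j) + cO K t τ) - c₀ K| ≤ vol * s K) →
      TermBudget l₀ vol T A B Bad
        (fun K t τ => (∑ j ∈ range (K + 1), sliceCentre (κ₁ K t τ)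
            (fun j => ∑ X ∈ fac K t τ with C.scale X = j,
              (-(EB (fun i => g (K + 1) (i + 1)) oneB X - EA (g K) oneA X)))
            (S K t τ) (fun j => Cw * vol * (Cr * θ' ^ j * Λ ^ (K - j))) j) + cO K t τ)
        (fun K t τ => (∑ j ∈ range (K + 1), min (S K t τ j) (Cw * vol * (Cr * θ' ^ j * Λ ^ (K - j))))
            + RO K t τ)
        c₀ (fun K => max Cw 1 * ((E + Cr) * ∑ x ∈ antidiagonal K, min (a ^ x.2) (θ' ^ x.1 * Λ ^ x.2)) + rO K)
        s := by
  obtain ⟨a₀, ha₀, hUK⟩ := uRateUpTo_of_nodes h9 hΛm hω hUL hG hP h5 hθ₅ hC₅ hloc hC₃ hθ₃ hθ₃1 hgd hinj hCd hθc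
    hbox hgA hgB hθ' hθ₅' hθ₃'
  have hθ'0 : 0 ≤ θ' := hθc.trans ((le_max_right ω θc).trans hθ'.le)
  have hm0 : 0 ≤ max ω θc := hω.trans (le_max_left _ _)
  have hC₉ : 0 ≤ C₉ := fadingMemory_const_nonneg hΛm
  have hD : 0 ≤ γ ^ 3 * Cd := mul_nonneg (pow_nonneg (box_nonneg hbox) 3) hCd
  have hCr : 0 ≤ a₀ + C₉ * (γ ^ 3 * Cd) * (θ' / (θ' - max ω θc)) + C₅ :=
    add_nonneg (add_nonneg ha₀ (mul_nonneg (mul_nonneg hC₉ hD) (div_nonneg hθ'0 (sub_pos.mpr hθ').le))) hC₅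
  refine ⟨a₀ + C₉ * (γ ^ 3 * Cd) * (θ' / (θ' - max ω θc)) + C₅, hCr, fun c₀ s hdev => ?_⟩
  exact termBudget_of_towerRate (gA := g) (gB := fun K i => g (K + 1) (i + 1)) (uA := fun K _ _ => uA K)
    (uB := fun K _ _ => uB K) (Adm := fun _ _ _ => R.dom) (Cr := fun _ => a₀ + C₉ * (γ ^ 3 * Cd) *
      (θ' / (θ' - max ω θc)) + C₅)
    hfmtA hfmtB hint hsc hposO hoff hS (fun K t _ τ _ => hUK K) hM hO hvol hE ha hθ'0 hΛ (fun _ => hCr) hSle hRO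
    hdev

/-- **… WHENCE THE GOOD CLAUSE WITH `Summable δ`** for `0 < a < 1`, `θ′ < 1`, `θ′ ≤ Λ` and summable `rO`, `s`
(`goodClause_summable_of_ledgerBudget` with the constant rate profile and `summable_eBranch_poly` at `p = 0`): together with
the weight budget `RelWeightBound` (NE7's other half), positivity and the partial-sum format of `Z`, this is every input of
`T4GoodClassBudget.cauchy_of_goodClause`. [folklore] -/
theorem goodClause_summable_of_nodes
    (h9 : NE9 EA W κ Λm) (hΛm : FadingMemory C₉ ω Λm) (hω : 0 ≤ ω)
    (hUL : LipBackground EA W κ CU) (hG : PolyLipGrowth CU g P q) (hP : 0 ≤ P)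
    (h5 : NE5 EA EB W κ θ₅ C₅) (hθ₅ : 0 ≤ θ₅) (hC₅ : 0 ≤ C₅)
    (hloc : LocalRate R C₃ θ₃) (hC₃ : 0 ≤ C₃) (hθ₃ : 0 ≤ θ₃) (hθ₃1 : θ₃ < 1) (hgd : GaugeDominated R uA uB)
    (hinj : InjectedRate Cd 0 θc (fun K j => T4CouplingMatching.disc (g K) (g (K + 1)) j)) (hCd : 0 ≤ Cd)
    (hθc : 0 ≤ θc) (hbox : ∀ K i, i ≤ K → 0 < g K i ∧ g K i ≤ γ)
    (hgA : ∀ K, g K ∈ W) (hgB : ∀ K, (fun i => g (K + 1) (i + 1)) ∈ W)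
    (hθ' : max ω θc < θ') (hθ₅' : θ₅ ≤ θ') (hθ₃' : θ₃ ≤ θ')
    (hfmtA : ∀ K t τ, A K t τ = ∫ v, (∏ X ∈ fac K t τ,
      Real.exp (EA (g K) (uA K v) X - EA (g K) oneA X)) * oA K t τ v ∂(μ K t τ))
    (hfmtB : ∀ K t τ, B K t τ = ∫ v, (∏ X ∈ fac K t τ,
      Real.exp (EB (fun i => g (K + 1) (i + 1)) (uB K v) X - EB (fun i => g (K + 1) (i + 1)) oneB X)) *
        oB K t τ v ∂(μ K t τ))
    (hint : ∀ K t, |t| ≤ l₀ → ∀ τ ∈ T K \ Bad K t,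
      Integrable (fun v => (∏ X ∈ fac K t τ, Real.exp (EA (g K) (uA K v) X - EA (g K) oneA X)) *
        oA K t τ v) (μ K t τ) ∧
      Integrable (fun v => (∏ X ∈ fac K t τ,
        Real.exp (EB (fun i => g (K + 1) (i + 1)) (uB K v) X - EB (fun i => g (K + 1) (i + 1)) oneB X)) *
        oB K t τ v) (μ K t τ))
    (hsc : ∀ K t, |t| ≤ l₀ → ∀ τ ∈ T K \ Bad K t, ∀ X ∈ fac K t τ, C.scale X ≤ K)
    (hposO : ∀ K t, |t| ≤ l₀ → ∀ τ ∈ T K \ Bad K t, ∀ v ∈ R.dom, 0 < oA K t τ v ∧ 0 < oB K t τ v)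
    (hoff : ∀ K t, |t| ≤ l₀ → ∀ τ ∈ T K \ Bad K t, ∀ v, v ∉ R.dom →
      (∏ X ∈ fac K t τ, Real.exp (EA (g K) (uA K v) X - EA (g K) oneA X)) * oA K t τ v = 0 ∧
      (∏ X ∈ fac K t τ,
        Real.exp (EB (fun i => g (K + 1) (i + 1)) (uB K v) X - EB (fun i => g (K + 1) (i + 1)) oneB X)) *
        oB K t τ v = 0)
    (hS : ∀ K t, |t| ≤ l₀ → ∀ τ ∈ T K \ Bad K t, ∀ v ∈ R.dom, ∀ j ≤ K,
      |(∑ X ∈ fac K t τ with C.scale X = j,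
          (Real.log (Real.exp (EB (fun i => g (K + 1) (i + 1)) (uB K v) X
              - EB (fun i => g (K + 1) (i + 1)) oneB X))
            - Real.log (Real.exp (EA (g K) (uA K v) X - EA (g K) oneA X)))) - κ₁ K t τ j| ≤ S K t τ j)
    (hM : ∀ K t, |t| ≤ l₀ → ∀ τ ∈ T K \ Bad K t,
      Multiplicity (fac K t τ) C.scale (fun X => Real.exp (-(κ * C.d X))) Cw vol Λ K)
    (hO : ∀ K t, |t| ≤ l₀ → ∀ τ ∈ T K \ Bad K t, ∀ v ∈ R.dom,
      |Real.log (oB K t τ v) - Real.log (oA K t τ v) - cO K t τ| ≤ RO K t τ)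
    (hvol : 0 ≤ vol) (hE : 0 ≤ E) (ha0 : 0 < a) (ha1 : a < 1) (hθ'1 : θ' < 1) (hθ'Λ : θ' ≤ Λ)
    (hSle : ∀ K t, |t| ≤ l₀ → ∀ τ ∈ T K \ Bad K t, ∀ j ≤ K, S K t τ j ≤ vol * (E * a ^ (K - j)))
    (hRO : ∀ K t, |t| ≤ l₀ → ∀ τ ∈ T K \ Bad K t, RO K t τ ≤ vol * rO K) (hrO : Summable rO) :
    ∃ Cr : ℝ, 0 ≤ Cr ∧ ∀ c₀ s : ℕ → ℝ, Summable s →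
      (∀ K t, |t| ≤ l₀ → ∀ τ ∈ T K \ Bad K t,
        |((∑ j ∈ range (K + 1), sliceCentre (κ₁ K t τ)
            (fun j => ∑ X ∈ fac K t τ with C.scale X = j,
              (-(EB (fun i => g (K + 1) (i + 1)) oneB X - EA (g K) oneA X)))
            (S K t τ) (fun j => Cw * vol * (Cr * θ' ^ j * Λ ^ (K - j))) j) + cO K t τ) - c₀ K| ≤ vol * s K) →
      GoodClause l₀ vol T A B Bad
          (fun K => (max Cw 1 * ((E + Cr) * ∑ x ∈ antidiagonal K, min (a ^ x.2) (θ' ^ x.1 * Λ ^ x.2)) + rO K)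
            + s K) ∧
        Summable (fun K => (max Cw 1 * ((E + Cr) * ∑ x ∈ antidiagonal K, min (a ^ x.2) (θ' ^ x.1 * Λ ^ x.2))
            + rO K) + s K) := by
  have hθ'0 : 0 < θ' := lt_of_le_of_lt (hθc.trans (le_max_right ω θc)) hθ'
  have hΛ : 0 ≤ Λ := hθ'0.le.trans hθ'Λ
  obtain ⟨Cr, hCr, hTB⟩ := termBudget_of_nodes h9 hΛm hω hUL hG hP h5 hθ₅ hC₅ hloc hC₃ hθ₃ hθ₃1 hgd hinj hCd hθc
    hbox hgA hgB hθ' hθ₅' hθ₃' hfmtA hfmtB hint hsc hposO hoff hS hM hO hvol hE ha0.le hΛ hSle hRO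
  refine ⟨Cr, hCr, fun c₀ s hs hdev => ?_⟩
  have hsum : Summable (fun K : ℕ => (E + Cr) * ∑ x ∈ antidiagonal K, min (a ^ x.2) (θ' ^ x.1 * Λ ^ x.2)) := by
    refine (summable_eBranch_poly (p := 0) hE hCr ha0 ha1 hθ'0 hθ'1 hθ'Λ).congr fun K => ?_
    rw [pow_zero, mul_one]
  exact goodClause_summable_of_ledgerBudget (Cr := fun _ => Cr) (hTB c₀ s hdev) hsum hrO hs

end Spine

/-! ## §4 Sanity: the nineteen binders of `termBudget_of_ledger` are jointly satisfiable by two runs that genuinely differ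
(v1.1 DOCFIX, cross-read advisory C-ref6-129 A1: v1 said «sixteen»; the theorem has nineteen named hypotheses =
thirteen substantive + six sign conditions; kernel unchanged) -/

section Toy

/-- TOY (no physics): one term per cutoff, one E-factor per creation scale `j ≤ K` over a one-point field space, run A's
factors `1`, run B's `exp(a^{K−j}θ^j)` — the two runs DIFFER at every cutoff, the log-ratio of slice `j` is `a^{K−j}θ^j`,
within the size radius (`E = 1`) and the rate radius (`Cw = Cr = Λ = 1`) of the centre `0`; the other kinds trivial.  All
binders of `termBudget_of_ledger` hold and the resulting `δ` is summable: the binder set is consistent and the sandwich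
orientation is the intended one. [folklore] -/
theorem toy_termBudget_nonvacuous {a θ : ℝ} (ha0 : 0 < a) (ha1 : a < 1) (hθ0 : 0 < θ) (hθ1 : θ < 1) :
    TermBudget (ι := Unit) 1 1 (fun _ => Finset.univ)
        (fun K _ _ => ∫ _v, (∏ _i ∈ range (K + 1), (1 : ℝ)) * 1 ∂(Measure.dirac ()))
        (fun K _ _ => ∫ _v, (∏ i ∈ range (K + 1), Real.exp (a ^ (K - i) * θ ^ i)) * 1 ∂(Measure.dirac ()))
        (fun _ _ => ∅)
        (fun K _ _ => (∑ j ∈ range (K + 1), sliceCentre (fun _ => 0) (fun _ => 0)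
          (fun j => a ^ (K - j) * θ ^ j) (fun j => a ^ (K - j) * θ ^ j) j) + 0)
        (fun K _ _ => (∑ j ∈ range (K + 1), min (a ^ (K - j) * θ ^ j) (a ^ (K - j) * θ ^ j)) + 0)
        (fun _ => 0)
        (fun K => max 1 1 * ((1 + 1) * ∑ x ∈ antidiagonal K, min (a ^ x.2) (θ ^ x.1 * 1 ^ x.2)) + 0)
        (fun _ => 0) ∧
      Summable (fun K : ℕ =>
        (max (1 : ℝ) 1 * ((1 + 1) * ∑ x ∈ antidiagonal K, min (a ^ x.2) (θ ^ x.1 * 1 ^ x.2)) + 0) + 0) := by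
  have hslice : ∀ K j, j ≤ K →
      (∑ i ∈ range (K + 1) with i = j, (Real.log (Real.exp (a ^ (K - i) * θ ^ i)) - Real.log 1))
        = a ^ (K - j) * θ ^ j := fun K j hj => by
    rw [Finset.filter_eq', if_pos (mem_range.mpr (Nat.lt_succ_of_le hj)), sum_singleton, Real.log_exp,
      Real.log_one, sub_zero]
  have hnn : ∀ K j, 0 ≤ a ^ (K - j) * θ ^ j := fun K j => mul_nonneg (pow_nonneg ha0.le _) (pow_nonneg hθ0.le _)
  have hT := termBudget_of_ledger (ι := Unit) (F := ℕ) (V := Unit) (l₀ := 1) (vol := 1)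
    (T := fun _ => Finset.univ) (Bad := fun _ _ => ∅)
    (A := fun K _ _ => ∫ _v, (∏ _i ∈ range (K + 1), (1 : ℝ)) * 1 ∂(Measure.dirac ()))
    (B := fun K _ _ => ∫ _v, (∏ i ∈ range (K + 1), Real.exp (a ^ (K - i) * θ ^ i)) * 1 ∂(Measure.dirac ()))
    (μ := fun _ _ _ => Measure.dirac ()) (Adm := fun _ _ _ => Set.univ) (fac := fun K _ _ => range (K + 1))
    (sc := fun i => i) (fA := fun _ _ _ _ _ => 1) (fB := fun K _ _ i _ => Real.exp (a ^ (K - i) * θ ^ i))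
    (oA := fun _ _ _ _ => 1) (oB := fun _ _ _ _ => 1) (κ₁ := fun _ _ _ _ => 0) (κ₂ := fun _ _ _ _ => 0)
    (S := fun K _ _ j => a ^ (K - j) * θ ^ j) (ρ := fun K _ _ j => a ^ (K - j) * θ ^ j)
    (cO := fun _ _ _ => 0) (RO := fun _ _ _ => 0) (c₀ := fun _ => 0) (s := fun _ => 0) (rO := fun _ => 0)
    (Cr := fun _ => 1) (Cw := 1) (E := 1) (a := a) (θ := θ) (Λ := 1)
    (fun _ _ _ => rfl) (fun _ _ _ => rfl)
    (fun _ _ _ _ _ => ⟨integrable_const _, integrable_const _⟩)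
    (fun K _ _ _ _ i hi => Nat.le_of_lt_succ (mem_range.mp hi))
    (fun _ _ _ _ _ _ _ => ⟨fun _ _ => ⟨one_pos, Real.exp_pos _⟩, one_pos, one_pos⟩)
    (fun _ _ _ _ _ v hv => absurd (Set.mem_univ v) hv)
    (fun K _ _ _ _ _ _ j hj => by rw [hslice K j hj, sub_zero, abs_of_nonneg (hnn K j)])
    (fun K _ _ _ _ _ _ j hj => by rw [hslice K j hj, sub_zero, abs_of_nonneg (hnn K j)])
    (fun _ _ _ _ _ _ _ => by rw [Real.log_one, sub_zero, sub_zero, abs_zero])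
    zero_le_one zero_le_one ha0.le hθ0.le zero_le_one (fun _ => zero_le_one)
    (fun K _ _ _ _ j _ => by
      rw [one_mul, one_mul]
      exact mul_le_of_le_one_right (pow_nonneg ha0.le _) (pow_le_one₀ hθ0.le hθ1.le))
    (fun K _ _ _ _ j _ => by
      rw [one_mul, one_mul, one_mul, one_pow, mul_one]
      exact mul_le_of_le_one_left (pow_nonneg hθ0.le _) (pow_le_one₀ ha0.le ha1.le))
    (fun _ _ _ _ _ => by rw [mul_zero])
    (fun K _ _ _ _ => by
      have h0 : ∀ j ∈ range (K + 1), sliceCentre (fun _ => (0 : ℝ)) (fun _ => 0) (fun j => a ^ (K - j) * θ ^ j)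
          (fun j => a ^ (K - j) * θ ^ j) j = 0 := fun j _ => by
        unfold sliceCentre
        split_ifs <;> rfl
      rw [sum_congr rfl h0, sum_const_zero, add_zero, sub_zero, abs_zero, mul_zero])
  refine ⟨hT, ?_⟩
  exact (goodClause_summable_of_ledgerBudget (Cr := fun _ => (1 : ℝ)) hT
    ((summable_eBranch_poly (p := 0) (E := 1) zero_le_one zero_le_one ha0 ha1 hθ0 hθ1 hθ1.le).congr
      fun K => by rw [pow_zero, mul_one])
    summable_zero summable_zero).2

end Toy

end Literature.MathematicalPhysics.QuantumFieldTheory.Balaban1983to89.T4TermwiseBudget
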